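import Literature.Analysis.FluidPDE.KNSSRegularityPlanar
import Literature.Analysis.FluidPDE.BoundedAnnihilator
import Literature.Analysis.FluidPDE.WholeSpaceIBP
import HarnessLib

/-!
# Planar vorticity calculus for KNSS 2009, Theorem 5.1

Analysis/FluidPDE proofs file (theorems only) on the decomposition path of
`Literature.Analysis.FluidPDE.KNSS2009_liouville_planar` (Koch–Nadirashvili–Seregin–Šverák,
Acta Math. 203 (2009) = arXiv:0709.3599, Theorem 5.1, p. 9). It supplies the elementary planar
vector calculus behind steps (3) and (4) of the printed proof, for the scalar curl
`Literature.Analysis.FluidPDE.curl2` of `KNSSRegularityPlanar`: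

* smoothness and derivative bounds of `ω = curl2 v = curl2CLM ∘ Dv` in terms of those of `v`
  (`contDiff_curl2`, `norm_iteratedFDeriv_curl2_le`, `curl2_sub`);
* **step (3), the flux bound**: `∫ ω χ = ∫ (v₀ ∂₁χ − v₁ ∂₀χ)` for `χ ∈ C¹_c` (integration by parts
  on the whole plane, `integral_curl2_mul_eq`), whence `|∫ ω χ| ≤ 2 ‖v‖_∞ ∫ ‖Dχ‖`; with the
  rescaled cut-offs `χ_R = χ₁(·/R)` (`Fluid.cutoff`) this gives: if `ω ≥ m ≥ 0` on the ball
  `B(0, 2R)` then `m R ∫χ₁ ≤ 2 ‖v‖_∞ ∫‖Dχ₁‖` (`curl2_mass_le`), the quantitative form of KNSS's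
  incompatibility of the two displayed estimates of the proof (p. 9: `∫_{Q_R} ω dx dt ≳ M₁ R⁴` on
  the balls of Lemma 2.1 against `∫_{Q_R} ω = ∫∫_{∂B_R × (t̄−R², t̄)} (u₂n₁ − u₁n₂) ds dt ≤ C R³`,
  "not compatible … unless `M₁ ≤ 0`"; a smooth cut-off replaces the sharp ball, and one time
  slice suffices);
* **step (4), the Liouville step**: a bounded `C²` planar field with `div v = 0` and
  `curl2 v = 0` is harmonic (`laplacian_eq_zero_of_isDivFree_of_curl2_eq_zero`, symmetry of
  second derivatives) and therefore constant (`apply_eq_apply_of_isDivFree_of_curl2_eq_zero`, by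
  the tree's Liouville theorem for bounded harmonic functions,
  `InnerProductSpace.HarmonicOnNhd.apply_eq_apply_of_abs_le`) — KNSS p. 9: "`curl u = 0` in
  `ℝ² × (−∞, 0)` which, together with `div u = 0` and the boundedness of `u`, implies (by the
  classical Liouville theorem for harmonic functions) that `u` is constant in `x` for each `t`".

## References

* G. Koch, N. Nadirashvili, G. Seregin, V. Šverák, *Liouville theorems for the Navier–Stokes
  equations and applications*, Acta Math. 203 (2009) 83–105 = arXiv:0709.3599: proof of
  Theorem 5.1 (arXiv p. 9, page numbers as in `KNSSLiouville`). [KochNadirashviliSereginSverak2009]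
-/

noncomputable section

open MeasureTheory Set Function Filter TopologicalSpace InnerProductSpace Metric
open scoped RealInnerProductSpace Laplacian ContDiff Topology

namespace Literature.Analysis.FluidPDE

/-- Local notation for the plane `ℝ² = EuclideanSpace ℝ (Fin 2)`. -/
local notation "ℝ²" => EuclideanSpace ℝ (Fin 2)

/-! ### Smoothness and derivative bounds of the planar vorticity -/

section Smooth

/-- The vorticity of a `C^{n+1}` planar field is `C^n` (`curl2 v = curl2CLM ∘ Dv`). [folklore] -/
theorem contDiff_curl2 {v : ℝ² → ℝ²} {n : ℕ∞} (hv : ContDiff ℝ (n + 1) v) :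
    ContDiff ℝ n (curl2 v) := by
  rw [curl2_eq_comp]
  exact curl2CLM.contDiff.comp (hv.fderiv_right le_rfl)

/-- The vorticity of a smooth planar field is smooth. [folklore] -/
theorem contDiff_curl2_infty {v : ℝ² → ℝ²} (hv : ContDiff ℝ ∞ v) : ContDiff ℝ ∞ (curl2 v) := by
  rw [curl2_eq_comp]
  exact curl2CLM.contDiff.comp (hv.fderiv_right le_rfl)

/-- **Derivative bounds for the vorticity**: `‖Dᵏ(curl2 v)(x)‖ ≤ ‖curl2CLM‖ ‖Dᵏ⁺¹v(x)‖` for a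
smooth planar field (`curl2 v = curl2CLM ∘ Dv` and `‖Dᵏ(Dv)‖ = ‖Dᵏ⁺¹v‖`). [folklore] -/
theorem norm_iteratedFDeriv_curl2_le {v : ℝ² → ℝ²} (hv : ContDiff ℝ ∞ v) (k : ℕ) (x : ℝ²) :
    ‖iteratedFDeriv ℝ k (curl2 v) x‖ ≤ ‖curl2CLM‖ * ‖iteratedFDeriv ℝ (k + 1) v x‖ := by
  rw [curl2_eq_comp, ← norm_iteratedFDeriv_fderiv]
  have hD : ContDiff ℝ ∞ (fderiv ℝ v) := hv.fderiv_right le_rfl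
  exact curl2CLM.norm_iteratedFDeriv_comp_left (hD.contDiffAt (x := x)) (by exact_mod_cast le_top)

/-- Pointwise bound `|curl2 v x| ≤ ‖curl2CLM‖ ‖Dv(x)‖`. [folklore] -/
theorem abs_curl2_le (v : ℝ² → ℝ²) (x : ℝ²) : |curl2 v x| ≤ ‖curl2CLM‖ * ‖fderiv ℝ v x‖ := by
  rw [curl2_eq_comp, Function.comp_apply, ← Real.norm_eq_abs]
  exact curl2CLM.le_opNorm _

/-- The vorticity is linear: `curl2 (v − w) = curl2 v − curl2 w` at points of
differentiability. [folklore] -/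
theorem curl2_sub {v w : ℝ² → ℝ²} {x : ℝ²} (hv : DifferentiableAt ℝ v x)
    (hw : DifferentiableAt ℝ w x) : curl2 (v - w) x = curl2 v x - curl2 w x := by
  simp only [curl2, fderiv_sub hv hw, sub_apply, PiLp.sub_apply]
  ring

/-- `curl2 (−v) = −curl2 v`. [folklore] -/
theorem curl2_neg (v : ℝ² → ℝ²) (x : ℝ²) : curl2 (-v) x = -curl2 v x := by
  simp only [curl2, fderiv_neg, neg_apply, PiLp.neg_apply]
  ring

/-- `curl2 (fun y => −v y) = fun y => −curl2 v y` (function form of `curl2_neg`). [folklore] -/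
theorem curl2_fun_neg (v : ℝ² → ℝ²) : curl2 (fun y => -v y) = fun y => -curl2 v y := by
  funext x
  exact curl2_neg v x

/-- The vorticity commutes with translations: `curl2 (v(· + a)) x = curl2 v (x + a)`. [folklore] -/
theorem curl2_comp_add_right (v : ℝ² → ℝ²) (a x : ℝ²) :
    curl2 (fun y => v (y + a)) x = curl2 v (x + a) := by
  simp only [curl2, fderiv_comp_add_right]

end Smooth

/-! ### Step (3): the flux bound `|∫ ω χ| ≤ 2‖v‖_∞ ∫‖Dχ‖` -/

section Flux

/-- A coordinate of a planar field: `D(v·ᵢ)(x)e = (Dv(x)e)ᵢ`. [folklore] -/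
theorem fderiv_apply_coord_fin2 {v : ℝ² → ℝ²} {x : ℝ²} (hv : DifferentiableAt ℝ v x) (i : Fin 2)
    (e : ℝ²) : fderiv ℝ (fun y => v y i) x e = fderiv ℝ v x e i := by
  have h : HasFDerivAt (⇑(EuclideanSpace.proj (𝕜 := ℝ) i) ∘ v)
      ((EuclideanSpace.proj i).comp (fderiv ℝ v x)) x :=
    (EuclideanSpace.proj i).hasFDerivAt.comp x hv.hasFDerivAt
  have h' : HasFDerivAt (fun y => v y i) ((EuclideanSpace.proj i).comp (fderiv ℝ v x)) x := h
  rw [h'.fderiv]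
  rfl

/-- **Integration by parts for one vorticity term**: for `v ∈ C¹` and `χ ∈ C¹_c`,
`∫ χ (Dv e)ᵢ = −∫ (Dχ e) vᵢ` (no boundary terms on the whole plane,
`integral_fderiv_apply_eq_zero` applied to `χ vᵢ`). [folklore] -/
theorem integral_mul_fderiv_coord_eq {v : ℝ² → ℝ²} (hv : ContDiff ℝ 1 v) {χ : ℝ² → ℝ}
    (hχ : ContDiff ℝ 1 χ) (hc : HasCompactSupport χ) (i : Fin 2) (e : ℝ²) :
    ∫ x, χ x * fderiv ℝ v x e i = -∫ x, fderiv ℝ χ x e * v x i := by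
  have hvi : ContDiff ℝ 1 fun y => v y i := (EuclideanSpace.proj (𝕜 := ℝ) i).contDiff.comp hv
  have hprod : ContDiff ℝ 1 fun y => χ y * v y i := hχ.mul hvi
  have hcs : HasCompactSupport fun y => χ y * v y i := hc.mul_right
  have key := integral_fderiv_apply_eq_zero hprod hcs e
  have hpt : ∀ x, fderiv ℝ (fun y => χ y * v y i) x e =
      fderiv ℝ χ x e * v x i + χ x * fderiv ℝ v x e i := by
    intro x
    have hχx : DifferentiableAt ℝ χ x := hχ.differentiable one_ne_zero x
    have hvx : DifferentiableAt ℝ (fun y => v y i) x := hvi.differentiable one_ne_zero x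
    rw [fderiv_fun_mul hχx hvx]
    simp only [add_apply, FunLike.coe_smul, Pi.smul_apply, smul_eq_mul]
    rw [fderiv_apply_coord_fin2 (hv.differentiable one_ne_zero x)]
    ring
  simp_rw [hpt] at key
  -- both summands are integrable (continuous with compact support)
  have hi1 : Integrable (fun x => fderiv ℝ χ x e * v x i) := by
    refine Continuous.integrable_of_hasCompactSupport ?_ ?_
    · exact ((hχ.continuous_fderiv one_ne_zero).clm_apply continuous_const).mul hvi.continuous
    · exact (hc.fderiv_apply (𝕜 := ℝ) e).mul_right
  have hi2 : Integrable (fun x => χ x * fderiv ℝ v x e i) := by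
    refine Continuous.integrable_of_hasCompactSupport ?_ hc.mul_right
    exact hχ.continuous.mul
      (((hv.continuous_fderiv one_ne_zero).clm_apply continuous_const) |>
        (EuclideanSpace.proj i).continuous.comp)
  rw [integral_add hi1 hi2] at key
  linarith

/-- **The vorticity flux identity**: for `v ∈ C¹(ℝ²; ℝ²)` and `χ ∈ C¹_c(ℝ²)`,
`∫ (curl2 v) χ = ∫ (v₀ ∂₁χ − v₁ ∂₀χ)` (`ω = ∂₀v₁ − ∂₁v₀` and two integrations by parts; the smooth
counterpart of KNSS's `∫_{B_R} ω dx = ∫_{∂B_R} (u₂n₁ − u₁n₂) ds` in the proof of Theorem 5.1). [cite: KochNadirashviliSereginSverak2009, proof of Thm 5.1, surface-integral estimate (arXiv p. 9)] -/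
theorem integral_curl2_mul_eq {v : ℝ² → ℝ²} (hv : ContDiff ℝ 1 v) {χ : ℝ² → ℝ}
    (hχ : ContDiff ℝ 1 χ) (hc : HasCompactSupport χ) :
    ∫ x, curl2 v x * χ x =
      ∫ x, (v x 0 * fderiv ℝ χ x (EuclideanSpace.single 1 1) -
        v x 1 * fderiv ℝ χ x (EuclideanSpace.single 0 1)) := by
  have h0 := integral_mul_fderiv_coord_eq hv hχ hc 1 (EuclideanSpace.single 0 1)
  have h1 := integral_mul_fderiv_coord_eq hv hχ hc 0 (EuclideanSpace.single 1 1)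
  have hcont : ∀ (i : Fin 2) (e : ℝ²), Continuous fun x => χ x * fderiv ℝ v x e i := fun i e =>
    hχ.continuous.mul (((hv.continuous_fderiv one_ne_zero).clm_apply continuous_const) |>
      (EuclideanSpace.proj i).continuous.comp)
  have hint : ∀ (i : Fin 2) (e : ℝ²), Integrable fun x => χ x * fderiv ℝ v x e i := fun i e =>
    (hcont i e).integrable_of_hasCompactSupport hc.mul_right
  have hcont' : ∀ (i : Fin 2) (e : ℝ²), Continuous fun x => fderiv ℝ χ x e * v x i := fun i e =>
    ((hχ.continuous_fderiv one_ne_zero).clm_apply continuous_const).mul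
      ((EuclideanSpace.proj (𝕜 := ℝ) i).contDiff.comp hv).continuous
  have hint' : ∀ (i : Fin 2) (e : ℝ²), Integrable fun x => fderiv ℝ χ x e * v x i := fun i e =>
    (hcont' i e).integrable_of_hasCompactSupport ((hc.fderiv_apply (𝕜 := ℝ) e).mul_right)
  calc ∫ x, curl2 v x * χ x
      = ∫ x, (χ x * fderiv ℝ v x (EuclideanSpace.single 0 1) 1 -
          χ x * fderiv ℝ v x (EuclideanSpace.single 1 1) 0) := by
        refine integral_congr_ae (Eventually.of_forall fun x => ?_)
        simp only [curl2]
        ring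
    _ = (∫ x, χ x * fderiv ℝ v x (EuclideanSpace.single 0 1) 1) -
          ∫ x, χ x * fderiv ℝ v x (EuclideanSpace.single 1 1) 0 :=
        integral_sub (hint _ _) (hint _ _)
    _ = (∫ x, fderiv ℝ χ x (EuclideanSpace.single 1 1) * v x 0) -
          ∫ x, fderiv ℝ χ x (EuclideanSpace.single 0 1) * v x 1 := by rw [h0, h1]; ring
    _ = ∫ x, (fderiv ℝ χ x (EuclideanSpace.single 1 1) * v x 0 -
          fderiv ℝ χ x (EuclideanSpace.single 0 1) * v x 1) :=
        (integral_sub (hint' _ _) (hint' _ _)).symm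
    _ = _ := by
        refine integral_congr_ae (Eventually.of_forall fun x => ?_)
        simp only
        ring

/-- **Flux bound**: `|∫ (curl2 v) χ| ≤ 2K ∫ ‖Dχ‖` for `v ∈ C¹` with `‖v‖ ≤ K` and `χ ∈ C¹_c`
(the vorticity flux identity and `|vᵢ| ≤ ‖v‖`, `‖eᵢ‖ = 1`; KNSS: "`≤ C R³`"). [cite: KochNadirashviliSereginSverak2009, proof of Thm 5.1, surface-integral estimate (arXiv p. 9)] -/
theorem abs_integral_curl2_mul_le {v : ℝ² → ℝ²} (hv : ContDiff ℝ 1 v) {K : ℝ} (hK : ∀ x, ‖v x‖ ≤ K)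
    {χ : ℝ² → ℝ} (hχ : ContDiff ℝ 1 χ) (hc : HasCompactSupport χ) :
    |∫ x, curl2 v x * χ x| ≤ 2 * K * ∫ x, ‖fderiv ℝ χ x‖ := by
  rw [integral_curl2_mul_eq hv hχ hc]
  have hK0 : 0 ≤ K := (norm_nonneg _).trans (hK 0)
  have hpt : ∀ x, |v x 0 * fderiv ℝ χ x (EuclideanSpace.single 1 1) -
      v x 1 * fderiv ℝ χ x (EuclideanSpace.single 0 1)| ≤ 2 * K * ‖fderiv ℝ χ x‖ := by
    intro x
    have h0 : |v x 0| ≤ K := by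
      have := PiLp.norm_apply_le (v x) 0
      rw [Real.norm_eq_abs] at this
      exact this.trans (hK x)
    have h1 : |v x 1| ≤ K := by
      have := PiLp.norm_apply_le (v x) 1
      rw [Real.norm_eq_abs] at this
      exact this.trans (hK x)
    have hd : ∀ i : Fin 2, |fderiv ℝ χ x (EuclideanSpace.single i 1)| ≤ ‖fderiv ℝ χ x‖ := by
      intro i
      have := (fderiv ℝ χ x).le_opNorm (EuclideanSpace.single i 1)
      rw [Real.norm_eq_abs] at this
      simpa using this
    calc |v x 0 * fderiv ℝ χ x (EuclideanSpace.single 1 1) -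
          v x 1 * fderiv ℝ χ x (EuclideanSpace.single 0 1)|
        ≤ |v x 0 * fderiv ℝ χ x (EuclideanSpace.single 1 1)| +
          |v x 1 * fderiv ℝ χ x (EuclideanSpace.single 0 1)| := abs_sub _ _
      _ = |v x 0| * |fderiv ℝ χ x (EuclideanSpace.single 1 1)| +
          |v x 1| * |fderiv ℝ χ x (EuclideanSpace.single 0 1)| := by rw [abs_mul, abs_mul]
      _ ≤ K * ‖fderiv ℝ χ x‖ + K * ‖fderiv ℝ χ x‖ := by
          gcongr
          · exact hd 1
          · exact hd 0
      _ = 2 * K * ‖fderiv ℝ χ x‖ := by ring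
  calc |∫ x, (v x 0 * fderiv ℝ χ x (EuclideanSpace.single 1 1) -
        v x 1 * fderiv ℝ χ x (EuclideanSpace.single 0 1))|
      ≤ ∫ x, |v x 0 * fderiv ℝ χ x (EuclideanSpace.single 1 1) -
        v x 1 * fderiv ℝ χ x (EuclideanSpace.single 0 1)| := by
        rw [← Real.norm_eq_abs]
        exact (norm_integral_le_integral_norm _).trans_eq (by simp_rw [Real.norm_eq_abs])
    _ ≤ ∫ x, 2 * K * ‖fderiv ℝ χ x‖ := by
        refine integral_mono_of_nonneg (Eventually.of_forall fun x => abs_nonneg _) ?_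
          (Eventually.of_forall hpt)
        exact ((hχ.continuous_fderiv one_ne_zero).norm.integrable_of_hasCompactSupport
          (hc.fderiv (𝕜 := ℝ)).norm).const_mul _
    _ = 2 * K * ∫ x, ‖fderiv ℝ χ x‖ := integral_const_mul _ _

end Flux

/-! ### Step (3), quantitative: near-maximal vorticity on large balls is impossible -/

section Mass

/-- **Mass bound with the rescaled cut-offs.** Let `v ∈ C¹(ℝ²; ℝ²)` with `‖v‖ ≤ K`, and suppose
`curl2 v ≥ m` on the ball `‖x‖ < 2R`. With `χ_R = χ₁(·/R)` (`Fluid.cutoff R`, equal to `1` on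
`B_R`, supported in `B_{2R}`, `0 ≤ χ_R ≤ 1`):
`m R² ∫χ₁ = m ∫χ_R ≤ ∫ ω χ_R ≤ 2K ∫‖Dχ_R‖ = 2K R ∫‖Dχ₁‖` (scaling of Lebesgue measure in the
plane, `Dχ_R = R⁻¹ Dχ₁(·/R)`), i.e. `m R ∫χ₁ ≤ 2K ∫‖Dχ₁‖`. This is KNSS's comparison of the
volume estimate `∫_{Q_R} ω ≳ M₁ R⁴` with the surface estimate `∫_{Q_R} ω ≤ C R³` (p. 9), on one
time slice and with a smooth cut-off. [cite: KochNadirashviliSereginSverak2009, proof of Thm 5.1, volume vs surface estimates (arXiv p. 9)] -/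
theorem curl2_mass_le {v : ℝ² → ℝ²} (hv : ContDiff ℝ 1 v) {K : ℝ} (hK : ∀ x, ‖v x‖ ≤ K)
    {R m : ℝ} (hR : 0 < R) (hω : ∀ x : ℝ², ‖x‖ < 2 * R → m ≤ curl2 v x) :
    m * R * ∫ x, (FunctionSpaces.dyadicCutoff ℝ² : ℝ² → ℝ) x ≤
      2 * K * ∫ x, ‖fderiv ℝ (FunctionSpaces.dyadicCutoff ℝ² : ℝ² → ℝ) x‖ := by
  set χ₁ : ℝ² → ℝ := (FunctionSpaces.dyadicCutoff ℝ² : ℝ² → ℝ) with hχ₁_def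
  set χ : ℝ² → ℝ := cutoff R with hχ_def
  have hχ₁c : ContDiff ℝ 1 χ₁ := (FunctionSpaces.dyadicCutoff ℝ²).contDiff
  have hχ₁s : HasCompactSupport χ₁ := (FunctionSpaces.dyadicCutoff ℝ²).hasCompactSupport
  have hχc : ContDiff ℝ 1 χ := contDiff_cutoff R
  have hχs : HasCompactSupport χ := hasCompactSupport_cutoff hR
  have hn : Module.finrank ℝ ℝ² = 2 := finrank_euclideanSpace_fin
  -- (1) mass of the cut-off: `∫ χ_R = R² ∫ χ₁`
  have hmass : ∫ x, χ x = R ^ 2 * ∫ x, χ₁ x := by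
    have h := Measure.integral_comp_inv_smul_of_nonneg volume χ₁ hR.le
    rw [hn, smul_eq_mul] at h
    exact h
  -- (2) mass of its gradient: `∫ ‖Dχ_R‖ = R ∫ ‖Dχ₁‖`
  have hgrad : ∫ x, ‖fderiv ℝ χ x‖ = R * ∫ x, ‖fderiv ℝ χ₁ x‖ := by
    have hpt : ∀ x, ‖fderiv ℝ χ x‖ = R⁻¹ * ‖fderiv ℝ χ₁ (R⁻¹ • x)‖ := by
      intro x
      have : fderiv ℝ χ x = R⁻¹ • fderiv ℝ χ₁ (R⁻¹ • x) :=
        fderiv_comp_smul (𝕜 := ℝ) (f := χ₁) (x := x) R⁻¹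
      rw [this, norm_smul, norm_inv, Real.norm_of_nonneg hR.le]
    simp_rw [hpt]
    rw [integral_const_mul]
    have h := Measure.integral_comp_inv_smul_of_nonneg volume (fun x => ‖fderiv ℝ χ₁ x‖) hR.le
    rw [hn, smul_eq_mul] at h
    rw [h]
    field_simp
  -- (3) lower bound: `m ∫ χ_R ≤ ∫ ω χ_R`
  have hv0 : ContDiff ℝ ((0 : ℕ∞) + 1) v := by simpa using hv
  have hωc : Continuous (curl2 v) := (contDiff_curl2 hv0).continuous
  have hint1 : Integrable (fun x => m * χ x) :=
    (hχc.continuous.integrable_of_hasCompactSupport hχs).const_mul m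
  have hint2 : Integrable (fun x => curl2 v x * χ x) :=
    (hωc.mul hχc.continuous).integrable_of_hasCompactSupport hχs.mul_left
  have hlow : m * ∫ x, χ x ≤ ∫ x, curl2 v x * χ x := by
    rw [← integral_const_mul]
    refine integral_mono hint1 hint2 fun x => ?_
    by_cases hx : ‖x‖ < 2 * R
    · exact mul_le_mul_of_nonneg_right (hω x hx) (cutoff_nonneg R x)
    · have : χ x = 0 := cutoff_eq_zero hR (not_lt.1 hx)
      simp [this]
  -- (4) upper bound: `∫ ω χ_R ≤ 2K ∫ ‖Dχ_R‖`
  have hup : ∫ x, curl2 v x * χ x ≤ 2 * K * ∫ x, ‖fderiv ℝ χ x‖ :=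
    (le_abs_self _).trans (abs_integral_curl2_mul_le hv hK hχc hχs)
  -- combine and divide by `R`
  have key : m * (R ^ 2 * ∫ x, χ₁ x) ≤ 2 * K * (R * ∫ x, ‖fderiv ℝ χ₁ x‖) := by
    rw [← hmass, ← hgrad]
    exact hlow.trans hup
  have hI : 0 ≤ ∫ x, χ₁ x := integral_nonneg fun x => (FunctionSpaces.dyadicCutoff ℝ²).nonneg
  have hJ : 0 ≤ ∫ x, ‖fderiv ℝ χ₁ x‖ := integral_nonneg fun x => norm_nonneg _
  have hK0 : 0 ≤ K := (norm_nonneg _).trans (hK 0)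
  have h1 : R * (m * R * ∫ x, χ₁ x) ≤ R * (2 * K * ∫ x, ‖fderiv ℝ χ₁ x‖) := by
    calc R * (m * R * ∫ x, χ₁ x) = m * (R ^ 2 * ∫ x, χ₁ x) := by ring
      _ ≤ 2 * K * (R * ∫ x, ‖fderiv ℝ χ₁ x‖) := key
      _ = R * (2 * K * ∫ x, ‖fderiv ℝ χ₁ x‖) := by ring
  exact le_of_mul_le_mul_left h1 hR

/-- **Step (3) of the proof of Theorem 5.1, as a contradiction.** There is no `m > 0` such that
for every radius `R` some planar field `v ∈ C¹` with `‖v‖ ≤ K` has `curl2 v ≥ m` on a ball of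
radius `R`: translate the ball to the origin and let `R → ∞` in `curl2_mass_le`
(`m R ∫χ₁ ≤ 2K ∫‖Dχ₁‖` with `∫χ₁ > 0`). KNSS p. 9: "Clearly [the volume estimate] is not
compatible with [the surface estimate], unless `M₁ ≤ 0`." [cite: KochNadirashviliSereginSverak2009, proof of Thm 5.1, volume vs surface estimates (arXiv p. 9)] -/
theorem false_of_curl2_ge_on_balls {K m : ℝ} (hm : 0 < m)
    (h : ∀ R > 0, ∃ (v : ℝ² → ℝ²) (y₀ : ℝ²), ContDiff ℝ 1 v ∧ (∀ x, ‖v x‖ ≤ K) ∧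
      ∀ x ∈ ball y₀ R, m ≤ curl2 v x) : False := by
  set I : ℝ := ∫ x, (FunctionSpaces.dyadicCutoff ℝ² : ℝ² → ℝ) x with hI_def
  set J : ℝ := ∫ x, ‖fderiv ℝ (FunctionSpaces.dyadicCutoff ℝ² : ℝ² → ℝ) x‖ with hJ_def
  have hI : 0 < I := (FunctionSpaces.dyadicCutoff ℝ²).integral_pos
  have hJ : 0 ≤ J := integral_nonneg fun x => norm_nonneg _
  -- a radius beyond the bound
  set R : ℝ := 2 * K * J / (m * I) + 1 with hR_def
  obtain ⟨v, y₀, hv, hK, hω⟩ := h (2 * R) (by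
    have hK0 : 0 ≤ K := by
      obtain ⟨v, y₀, -, hK, -⟩ := h 1 one_pos
      exact (norm_nonneg _).trans (hK 0)
    have : 0 ≤ 2 * K * J / (m * I) := div_nonneg (by positivity) (by positivity)
    linarith)
  have hK0 : 0 ≤ K := (norm_nonneg _).trans (hK 0)
  have hR : 0 < R := by
    have : 0 ≤ 2 * K * J / (m * I) := div_nonneg (by positivity) (by positivity)
    linarith
  -- translate the ball to the origin
  set w : ℝ² → ℝ² := fun x => v (x + y₀) with hw_def
  have hw : ContDiff ℝ 1 w := hv.comp (contDiff_id.add contDiff_const)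
  have hwK : ∀ x, ‖w x‖ ≤ K := fun x => hK _
  have hwω : ∀ x : ℝ², ‖x‖ < 2 * R → m ≤ curl2 w x := by
    intro x hx
    rw [hw_def, curl2_comp_add_right]
    exact hω _ (by rwa [mem_ball, dist_eq_norm, add_sub_cancel_right])
  have key := curl2_mass_le hw hwK hR hwω
  -- `m R I ≤ 2 K J` contradicts the choice of `R`
  have h1 : R ≤ 2 * K * J / (m * I) := by
    rw [le_div_iff₀ (mul_pos hm hI)]
    calc R * (m * I) = m * R * I := by ring
      _ ≤ 2 * K * J := key
  linarith

end Mass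

/-! ### Step (4): irrotational incompressible bounded planar fields are constant -/

section Liouville

/-- **`div v = 0` and `curl2 v = 0` imply `Δv = 0`** for a `C²` planar field: with
`S = D²v(x)` (symmetric), `div` gives `(S w e₀)₀ + (S w e₁)₁ = 0` and `curl2` gives
`(S w e₀)₁ − (S w e₁)₀ = 0` for every `w`, and `Δv = S e₀ e₀ + S e₁ e₁` vanishes componentwise.
(The vector identity `Δ = ∇ div − curl curl` in the plane.) [folklore] -/
theorem laplacian_eq_zero_of_isDivFree_of_curl2_eq_zero {v : ℝ² → ℝ²} (hv : ContDiff ℝ 2 v)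
    (hdiv : VectorCalculus.IsDivFree v) (hcurl : ∀ x, curl2 v x = 0) (x : ℝ²) : Δ v x = 0 := by
  -- second derivative and its symmetry
  have h1 : ContDiff ℝ 1 (fderiv ℝ v) := hv.fderiv_right one_add_one_eq_two.le
  set S := fderiv ℝ (fderiv ℝ v) x with hS
  have hD2 : HasFDerivAt (fderiv ℝ v) S x := (h1.differentiable one_ne_zero x).hasFDerivAt
  have hsymm : IsSymmSndFDerivAt ℝ v x := hv.contDiffAt.isSymmSndFDerivAt (by simp)
  set e₀ : ℝ² := EuclideanSpace.single 0 1 with he₀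
  set e₁ : ℝ² := EuclideanSpace.single 1 1 with he₁
  -- the divergence as a linear function of the gradient, differentiated
  let Ldiv : (ℝ² →L[ℝ] ℝ²) →L[ℝ] ℝ :=
    (EuclideanSpace.proj 0).comp (ContinuousLinearMap.apply ℝ ℝ² e₀) +
      (EuclideanSpace.proj 1).comp (ContinuousLinearMap.apply ℝ ℝ² e₁)
  have hLdiv : ∀ T : ℝ² →L[ℝ] ℝ², Ldiv T = T e₀ 0 + T e₁ 1 := fun T => rfl
  have hdiv' : (fun y => Ldiv (fderiv ℝ v y)) = fun _ => 0 := by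
    funext y
    rw [hLdiv, ← hdiv y, divergence_eq_sum_inner_fderiv (EuclideanSpace.basisFun (Fin 2) ℝ)]
    simp [Fin.sum_univ_two, EuclideanSpace.basisFun_apply, EuclideanSpace.inner_single_left, he₀,
      he₁]
  have hDdiv : fderiv ℝ (fun y => Ldiv (fderiv ℝ v y)) x = Ldiv.comp S :=
    (Ldiv.hasFDerivAt.comp x hD2).fderiv
  rw [hdiv'] at hDdiv
  simp only [fderiv_fun_const, Pi.zero_apply] at hDdiv
  have hdivS : ∀ w, S w e₀ 0 + S w e₁ 1 = 0 := fun w => by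
    have := DFunLike.congr_fun hDdiv w
    rw [zero_apply, ContinuousLinearMap.comp_apply, hLdiv] at this
    exact this.symm
  -- the curl as a linear function of the gradient, differentiated
  have hcurl' : (fun y => curl2CLM (fderiv ℝ v y)) = fun _ => 0 := by
    funext y
    exact hcurl y
  have hDcurl : fderiv ℝ (fun y => curl2CLM (fderiv ℝ v y)) x = curl2CLM.comp S :=
    (curl2CLM.hasFDerivAt.comp x hD2).fderiv
  rw [hcurl'] at hDcurl
  simp only [fderiv_fun_const, Pi.zero_apply] at hDcurl
  have hcurlS : ∀ w, S w e₀ 1 - S w e₁ 0 = 0 := fun w => by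
    have := DFunLike.congr_fun hDcurl w
    rw [zero_apply, ContinuousLinearMap.comp_apply, curl2CLM_apply] at this
    exact this.symm
  -- the Laplacian in the standard frame
  have hΔ : Δ v x = S e₀ e₀ + S e₁ e₁ := by
    rw [laplacian_eq_sum_fderiv_fderiv (EuclideanSpace.basisFun (Fin 2) ℝ) hv x]
    simp only [Fin.sum_univ_two, EuclideanSpace.basisFun_apply, ← he₀, ← he₁]
    have hdd : ∀ e : ℝ², fderiv ℝ (fun y => fderiv ℝ v y e) x e = S e e := fun e => by
      rw [fderiv_clm_apply (h1.differentiable one_ne_zero x) (differentiableAt_const e)]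
      simp [hS]
    rw [hdd, hdd]
  rw [hΔ]
  have h01 : S e₀ e₁ = S e₁ e₀ := hsymm e₀ e₁
  ext i
  fin_cases i
  · -- component 0
    have hd := hdivS e₀
    have hc := hcurlS e₁
    simp only [PiLp.add_apply, PiLp.zero_apply]
    have : S e₁ e₁ 0 = S e₁ e₀ 1 := by linarith
    rw [← h01] at this
    show S e₀ e₀ 0 + S e₁ e₁ 0 = 0
    linarith
  · -- component 1
    have hd := hdivS e₁
    have hc := hcurlS e₀
    simp only [PiLp.add_apply, PiLp.zero_apply]
    rw [h01] at hc
    show S e₀ e₀ 1 + S e₁ e₁ 1 = 0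
    linarith

/-- **The Liouville step of the proof of Theorem 5.1** (KNSS 2009, p. 9: "`curl u = 0` … which,
together with `div u = 0` and the boundedness of `u`, implies (by the classical Liouville theorem
for harmonic functions) that `u` is constant in `x`"): a bounded `C²` planar field with
`div v = 0` and `curl2 v = 0` is constant — each coordinate is a bounded harmonic function
(`laplacian_eq_zero_of_isDivFree_of_curl2_eq_zero`,
`InnerProductSpace.HarmonicOnNhd.apply_eq_apply_of_abs_le`). [cite: KochNadirashviliSereginSverak2009, proof of Thm 5.1, last sentence (arXiv p. 9)] -/
theorem apply_eq_apply_of_isDivFree_of_curl2_eq_zero {v : ℝ² → ℝ²} (hv : ContDiff ℝ 2 v)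
    (hdiv : VectorCalculus.IsDivFree v) (hcurl : ∀ x, curl2 v x = 0) {K : ℝ}
    (hK : ∀ x, ‖v x‖ ≤ K) (x y : ℝ²) : v x = v y := by
  have hharm : HarmonicOnNhd v univ := fun z _ =>
    ⟨hv.contDiffAt, Eventually.of_forall fun w =>
      laplacian_eq_zero_of_isDivFree_of_curl2_eq_zero hv hdiv hcurl w⟩
  ext i
  have hi : HarmonicOnNhd (⇑(EuclideanSpace.proj (𝕜 := ℝ) i) ∘ v) univ :=
    hharm.comp_CLM (EuclideanSpace.proj i)
  have hb : ∀ z, |(⇑(EuclideanSpace.proj (𝕜 := ℝ) i) ∘ v) z| ≤ K := fun z => by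
    have := PiLp.norm_apply_le (v z) i
    rw [Real.norm_eq_abs] at this
    exact this.trans (hK z)
  exact hi.apply_eq_apply_of_abs_le hb x y

end Liouville

end Literature.Analysis.FluidPDE

end
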